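import Literature.AnabelianGeometry.EtaleTheta.ThetaEnvOfSetting
import Literature.AnabelianGeometry.EtaleTheta.ConstantMultipleRigidity
import HarnessLib

/-!
# [EtTh] §2 over §1: Definition 2.7 and Definition 2.13 (iv) — "standard type" for the orbits of the
# root of the étale theta class and for the model bi-theta environment (merge adapter, part 2b)

Mochizuki, *The étale theta function …*, Publ. RIMS **45** (2009), §2, PRIMS PDF p. 41 (Def. 2.7) and
p. 48 (Def. 2.13 (iv)) (printed 267, 274) [cite: MochizukiEtTh2009, Def 2.13 (iv) p.48]. Layer L2 of
the abc-iut cell, wave-2 unit W2-L2-04, seat abc-iut-L2-t8 (L2-lead 19:09:33Z: "Def 2.13 (iv) lands via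
t8's adapter with t1's `IsStandardType` as an explicit hypothesis").

Both printed definitions are TRANSFERS of seat abc-iut-L2-t1's §1 predicate
`MuTwoSetting.IsOfStandardType` (Def. 1.9 (ii), `ConstantMultipleRigidity.lean`: the value of maximal
order of a standard set of values of `η̈^{Θ,ℤ}` is `±1`) along the constructions of this adapter:

* Def. 2.7: "If `η̈^{Θ,ℤ}` is of standard type, then we shall also refer to `η̈^{Θ,l·ℤ}`, `η̲̈^{Θ,l·ℤ}`,
  `η̈^{Θ,l·ℤ×μ₂}`, `η̲̈^{Θ,l·ℤ×μ₂}`, `η̈^{Θ,ℤ×μ₂}` as being of standard type" — `OrbitsOfStandardType`;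
* Def. 2.13 (iv): "if `η̲̈^{Θ,l·ℤ×μ₂}` is of standard type, then we shall refer to the resulting [mod `N`]
  model bi-theta environment as being of standard type" — `IsModelBiOfStandardType`, a predicate on
  abc-iut-L2-t2's `BiThetaEnv` (`MonoThetaEnv.lean`) over the instantiated data
  `DoubleUnderline.thetaEnvData` (whose `modelBi` is Def. 2.13 (iii)).

The §1 setting here is t1's `MuTwoSetting p` (Def. 1.7: `K = K̈`, `Π^tp_C ⊇ Π^tp_X`, `ε_μ`, `ε_±`), the
orbit `η̈^{Θ,ℤ}` being taken inside `Π^tp_Ẋ` for an admissible `ε_Z` and a `StandardData` (`√−1 ∈ K`, the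
points `τ^{±1}`). Definitions only; nothing is asserted. HONEST FRAMING as in parts 0–3.
-/

noncomputable section

namespace Literature.AnabelianGeometry.EtaleTheta

open Literature.AnabelianGeometry.SemiGraphs

namespace MuTwoSetting

variable {p : ℕ} [Fact p.Prime] {M : MuTwoSetting p}

/-- **Definition 2.7** (p. 41): the orbits `η̈^{Θ,l·ℤ}`, `η̲̈^{Θ,l·ℤ}`, `η̈^{Θ,l·ℤ×μ₂}`, `η̲̈^{Θ,l·ℤ×μ₂}`,
`η̈^{Θ,ℤ×μ₂}` derived from the étale theta class `η̈^Θ = E.etaDd` (p. 41) are *of standard type* iff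
`η̈^{Θ,ℤ}` — its `Π^tp_Ẋ/Π^tp_Ÿ ≅ ℤ`-orbit for the admissible `ε_Z` — is of standard type in the sense of
Def. 1.9 (ii) (abc-iut-L2-t1's `MuTwoSetting.IsOfStandardType`); the choice `C` of `X̲̲` enters only
through the orbits it names. [cite: MochizukiEtTh2009, Def 2.7 p.41] -/
def OrbitsOfStandardType {E : M.toThetaSetting.EtaleThetaData} {l : ℕ}
    (_C : E.DoubleUnderline l) (hC : M.toThetaSetting.Compat) (εZ : M.GtpC)
    (S : M.StandardData E.toKummerData) : Prop :=
  M.IsOfStandardType hC εZ S E.etaDd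

/-- **Definition 2.13 (iv)** (p. 48): "In the situation of (iii), if `η̲̈^{Θ,l·ℤ×μ₂}` is of standard type,
then we shall refer to the resulting [mod `N`] model bi-theta environment as being of standard type" —
a predicate on bi-theta environment data `B`: `B` IS one of the model bi-theta environments
(Def. 2.13 (iii), `ThetaEnvData.modelBi` over the instantiated data of `X̲̲`) built from a cocycle of the
collection, AND the orbits are of standard type (Def. 2.7).
[cite: MochizukiEtTh2009, Def 2.13 (iv) p.48] -/
def IsModelBiOfStandardType {E : M.toThetaSetting.EtaleThetaData} {l : ℕ} {N : ℕ+}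
    (C : E.DoubleUnderline l) (μ : M.toThetaSetting.CyclotomeMod l N) (hC : M.toThetaSetting.Compat)
    (hS : M.toThetaSetting.Sec2Hyps) (εZ : M.GtpC) (S : M.StandardData E.toKummerData)
    (B : BiThetaEnv.{0}) : Prop :=
  (∃ (η : (C.thetaEnvData μ hC hS).PiYdd → MuN p N) (hη : η ∈ (C.thetaEnvData μ hC hS).thetaCocycles),
      B = (C.thetaEnvData μ hC hS).modelBi hη) ∧
    OrbitsOfStandardType C hC εZ S

/-- A model bi-theta environment of standard type is, in particular, a bi-theta environment
(Def. 2.13 (iii): isomorphic — by the identity — to a model one).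
[cite: MochizukiEtTh2009, Def 2.13 (iv) p.48] -/
theorem IsModelBiOfStandardType.isBiThetaEnv {E : M.toThetaSetting.EtaleThetaData} {l : ℕ} {N : ℕ+}
    {C : E.DoubleUnderline l} {μ : M.toThetaSetting.CyclotomeMod l N} {hC : M.toThetaSetting.Compat}
    {hS : M.toThetaSetting.Sec2Hyps} {εZ : M.GtpC} {S : M.StandardData E.toKummerData}
    {B : BiThetaEnv.{0}} (h : IsModelBiOfStandardType C μ hC hS εZ S B) :
    (C.thetaEnvData μ hC hS).IsBiThetaEnv B := by
  obtain ⟨⟨η, hη, rfl⟩, -⟩ := h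
  refine ⟨η, hη, ⟨?_⟩⟩
  exact
    { e := ContinuousMulEquiv.refl _
      map_D := by
        have : TopOut.transport (ContinuousMulEquiv.refl ((C.thetaEnvData μ hC hS).modelBi hη).Pi) =
            MonoidHom.id _ := by
          ext ⟨φ⟩; rfl
        rw [this]; exact Subgroup.map_id _
      map_sTheta := by
        have : (fun H : Subgroup ((C.thetaEnvData μ hC hS).modelBi hη).Pi =>
            H.map (ContinuousMulEquiv.refl _).toMulEquiv.toMonoidHom) = id := by
          funext H; exact Subgroup.map_id H
        rw [this, Set.image_id]
      map_sAlg := by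
        have : (fun H : Subgroup ((C.thetaEnvData μ hC hS).modelBi hη).Pi =>
            H.map (ContinuousMulEquiv.refl _).toMulEquiv.toMonoidHom) = id := by
          funext H; exact Subgroup.map_id H
        rw [this, Set.image_id] }

end MuTwoSetting

end Literature.AnabelianGeometry.EtaleTheta

end
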